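import Summits.ResolutionOfSingularities.ResolutionOfSingularities.Theses.PAlteration
import Summits.ResolutionOfSingularities.ResolutionOfSingularities.Theorems.PAlterationPialtStubSplitData
import Summits.ResolutionOfSingularities.ResolutionOfSingularities.Theorems.PAlterationPialtStubImageNeUniv
import Summits.ResolutionOfSingularities.ResolutionOfSingularities.Theorems.PAlterationPialtStubFrobIndetOfPialt
import Summits.ResolutionOfSingularities.ResolutionOfSingularities.Theorems.PAlterationPialtStubPiRegModelOfBirational
import Summits.ResolutionOfSingularities.ResolutionOfSingularities.Theorems.PAlterationPialtStubHypersurfaceModel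
import Summits.ResolutionOfSingularities.ResolutionOfSingularities.Theorems.PAlterationPialtNormalProper
import Summits.ResolutionOfSingularities.ResolutionOfSingularities.Theorems.PAlterationPalterationThesisPialtOfPerfect
import Literature.AlgebraicGeometry.Motives.VarietiesProperProofs
import HarnessLib

/-!
# `Pialt` (crux stmt-ResolutionOfSingularities-0555), line `IndeterminacySplit`: the SPLIT GLUE along
# the birational seam — `Pialt ⇐ FrobIndet ∧ HypersurfacePialt`

Helper file of the line lead (c2), `--supports stmt-ResolutionOfSingularities-0555`; it does not
close any item. With the two KNOWN stubs of the strategist's alternative line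
`Cruxes/Pialt/Lines/IndeterminacySplit.lean` now LANDED (`stub_hypersurfaceModel`, p139710 — every
integral variety over a perfect field is birational to an integral hypersurface of a projective
space; `stub_piRegModel_of_birational`, p138968 — the crux conclusion transfers across a
birational identification of opens into a regular purely inseparable MODEL), the composition of
that line is available as a CLOSED theorem whose two hypotheses are, VERBATIM, its two OPEN
registered stubs (quantified over all primes and all perfect ground fields):

* `hI` = `stub_frobIndet` — **FrobIndet**, purely inseparable elimination of indeterminacy of
  rational maps out of REGULAR proper varieties over a perfect field (open from dimension 4;
  converse direction landed: `stub_frobIndet_of_pialtOver`);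
* `hH` = `stub_hypersurfacePialt` — **the crux for integral hypersurfaces of `ℙⁿ⁺¹_k`**, `k`
  perfect (open from dimension 4; a special case of the crux).

`pialt_of_frobIndet_hypersurfacePialt : (∀ p, p.Prime → ∀ k perfect of char p, FrobIndet at k) →
(∀ p, p.Prime → ∀ k perfect of char p, HypersurfacePialt at k) → Pialt` — usable by a planner as
`route edit --split Pialt --glue-by` for the birational-seam split (the strategist's RECOMMENDED
split, `Cruxes/Pialt/STRATEGY-CENSUS.md`). Field by field: `piRegModel_of_hypersurfacePialt`
(hypersurface road to a regular purely inseparable model), `pialtShape_proper_of_frobIndet_piRegModel`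
(the split at a proper variety: `stub_image_ne_univ_of_isClosed` + `stub_pialtShape_of_split_data`,
lead a2), `pialtShape_of_frobIndet_hypersurfacePialt` (any variety: `pialtConclusion_of_forall_normal_proper`);
every field by `stub_pialtOfPerfect`. No new definitions (the statements are inlined).

Sources: D. Abramovich, F. Oort, Progr. Math. 181 (2000), Q. 2.13; M. Temkin, J. Algebra 373 (2013),
Conj. 1.3.1; R. Hartshorne, *Algebraic Geometry* (1977), I Prop. 4.9.
-/

set_option linter.dupNamespace false -- mandated namespace of this single-conjunct summit

noncomputable section

open CategoryTheory CategoryTheory.Limits AlgebraicGeometry TopologicalSpace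
open Literature.AlgebraicGeometry.Resolution
open Literature.AlgebraicGeometry.Motives (projectiveSpace isProper_projectiveSpace)

namespace Summit.ResolutionOfSingularities.ResolutionOfSingularities.Theorems.Pialt.IndeterminacySplit

/-! ## Field by field -/

/-- **The hypersurface road to a regular purely inseparable model.** Over a perfect field `k` of
characteristic `p`, if every integral hypersurface `H ⊆ ℙⁿ⁺¹_k` of dimension `n` satisfies the
conclusion of the crux (`hH`, the registered stub `stub_hypersurfacePialt` at `p, k`), then every
proper integral `X / k` has a regular proper purely inseparable model: hypersurface model
(`stub_hypersurfaceModel`, landed), the crux for it (`H` is proper over `k`: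
`isProper_projectiveSpace`), transfer across the birational identification
(`stub_piRegModel_of_birational`, landed). [cite: Hartshorne1977, I Prop. 4.9] -/
theorem piRegModel_of_hypersurfacePialt (p : ℕ) (hp : p.Prime) (k : Type) [Field k] [CharP k p]
    [PerfectField k]
    (hH : ∀ (n : ℕ) (H : Scheme.{0}) (ι : H ⟶ (Literature.AlgebraicGeometry.Motives.projectiveSpace (n + 1) k).left),
      IsClosedImmersion ι → IsIntegral H → topologicalKrullDim H = (n : WithBot ℕ∞) →
      ∃ (H' : Scheme.{0}) (g : H' ⟶ H), IsProper g ∧ IsIntegral H' ∧ Scheme.IsRegular H' ∧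
        Function.Surjective g.base ∧ ∃ U : H.Opens, Dense (U : Set H) ∧ IsFinite (g ∣_ U) ∧
          UniversallyInjective (g ∣_ U))
    (X : Scheme.{0}) (f : X ⟶ Spec (.of k)) [IsProper f] [IsIntegral X] :
    ∃ (Y : Scheme.{0}) (h : Y ⟶ Spec (.of k)), IsProper h ∧ IsIntegral Y ∧ Scheme.IsRegular Y ∧
      ∃ (U : X.Opens) (V : Y.Opens) (ψ : (V : Scheme.{0}) ⟶ (U : Scheme.{0})),
        (U : Set X).Nonempty ∧ IsFinite ψ ∧ UniversallyInjective ψ ∧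
          Function.Surjective ψ.base ∧ V.ι ≫ h = ψ ≫ U.ι ≫ f := by
  have _ := hp
  obtain ⟨n, H, ι, hι, hHi, hdim, U, W, e, he, hU, hcomm⟩ := stub_hypersurfaceModel k X f
  haveI := hι; haveI := hHi; haveI := he
  haveI : IsProper (projectiveSpace (n + 1) k).hom := isProper_projectiveSpace (n + 1) k
  haveI : IsProper (ι ≫ (projectiveSpace (n + 1) k).hom) := inferInstance
  have hPH := hH n H ι hι hHi hdim
  exact stub_piRegModel_of_birational k X f H (ι ≫ (projectiveSpace (n + 1) k).hom) U W e hU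
    (by simpa only [Category.assoc] using hcomm) hPH

/-- **The split at a proper variety.** Over a perfect field `k` of characteristic `p`, FrobIndet
at `k` (`hI`, the registered stub `stub_frobIndet` at `p, k`) and the crux for hypersurfaces at
`k` (`hH`) give the conclusion of the crux at every PROPER integral `X / k`: take a regular
purely inseparable model `ψ : V → U ⊆ X` of `X` (`piRegModel_of_hypersurfacePialt`), eliminate the
indeterminacy of the rational map `Y ⊇ V → X` by a purely inseparable regular alteration
`g : Y' → Y` (`hI`), and assemble (`stub_image_ne_univ_of_isClosed`,
`stub_pialtShape_of_split_data`). [cite: AbramovichOort2000, Q. 2.13] -/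
theorem pialtShape_proper_of_frobIndet_hypersurfacePialt (p : ℕ) (hp : p.Prime) (k : Type)
    [Field k] [CharP k p] [PerfectField k]
    (hI : ∀ (Y X₁ : Scheme.{0}) (fY : Y ⟶ Spec (.of k)) (f₁ : X₁ ⟶ Spec (.of k)), IsProper fY →
      IsProper f₁ → IsIntegral Y → Scheme.IsRegular Y → IsIntegral X₁ →
      ∀ (V : Y.Opens) (φ : (V : Scheme.{0}) ⟶ X₁), (V : Set Y).Nonempty → V.ι ≫ fY = φ ≫ f₁ →
        ∃ (Y' : Scheme.{0}) (g : Y' ⟶ Y) (ψ : Y' ⟶ X₁), IsProper g ∧ IsIntegral Y' ∧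
          Scheme.IsRegular Y' ∧ Function.Surjective g.base ∧
          (∃ V' : Y.Opens, Dense (V' : Set Y) ∧ IsFinite (g ∣_ V') ∧
            UniversallyInjective (g ∣_ V')) ∧
          ψ ≫ f₁ = g ≫ fY ∧ (g ⁻¹ᵁ V).ι ≫ ψ = (g ∣_ V) ≫ φ)
    (hH : ∀ (n : ℕ) (H : Scheme.{0}) (ι : H ⟶ (Literature.AlgebraicGeometry.Motives.projectiveSpace (n + 1) k).left),
      IsClosedImmersion ι → IsIntegral H → topologicalKrullDim H = (n : WithBot ℕ∞) →
      ∃ (H' : Scheme.{0}) (g : H' ⟶ H), IsProper g ∧ IsIntegral H' ∧ Scheme.IsRegular H' ∧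
        Function.Surjective g.base ∧ ∃ U : H.Opens, Dense (U : Set H) ∧ IsFinite (g ∣_ U) ∧
          UniversallyInjective (g ∣_ U))
    (X : Scheme.{0}) (f : X ⟶ Spec (.of k)) [IsProper f] [IsIntegral X] :
    ∃ (X' : Scheme.{0}) (g : X' ⟶ X), IsProper g ∧ IsIntegral X' ∧ Scheme.IsRegular X' ∧
      Function.Surjective g.base ∧ ∃ U : X.Opens, Dense (U : Set X) ∧ IsFinite (g ∣_ U) ∧
        UniversallyInjective (g ∣_ U) := by
  obtain ⟨Y, h, hh, hY, hYreg, U, V, ψ, hU, hfin, hui, hψs, hcomm⟩ :=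
    piRegModel_of_hypersurfacePialt p hp k hH X f
  haveI := hh; haveI := hY; haveI := hfin; haveI := hui
  have hV : (V : Set Y).Nonempty := by
    obtain ⟨x, hx⟩ := hU
    obtain ⟨v, -⟩ := hψs ⟨x, hx⟩
    exact ⟨v.1, v.2⟩
  have hφ : V.ι ≫ h = (ψ ≫ U.ι) ≫ f := by
    rw [Category.assoc]
    exact hcomm
  obtain ⟨Y', g, ψ', hg, hY', hY'reg, hgs, ⟨V', hV', hfin', hui'⟩, hψ'f, hcompat⟩ :=
    hI Y X h f hh inferInstance hY hYreg inferInstance V (ψ ≫ U.ι) hV hφ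
  haveI := hg; haveI := hY'; haveI := hfin'; haveI := hui'
  have hC := stub_image_ne_univ_of_isClosed k X f Y h U V ψ hU hψs hcomm Y' g hgs V' hV' ψ' hψ'f
  exact stub_pialtShape_of_split_data k X f Y h U V ψ hU hψs hcomm Y' g hgs V' hV' ψ' hψ'f
    hY'reg hcompat hC

/-- **The split at an arbitrary variety over one perfect field** (reduce to normal proper `X`:
`pialtConclusion_of_forall_normal_proper`). [folklore] -/
theorem pialtShape_of_frobIndet_hypersurfacePialt (p : ℕ) (hp : p.Prime) (k : Type) [Field k]
    [CharP k p] [PerfectField k]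
    (hI : ∀ (Y X₁ : Scheme.{0}) (fY : Y ⟶ Spec (.of k)) (f₁ : X₁ ⟶ Spec (.of k)), IsProper fY →
      IsProper f₁ → IsIntegral Y → Scheme.IsRegular Y → IsIntegral X₁ →
      ∀ (V : Y.Opens) (φ : (V : Scheme.{0}) ⟶ X₁), (V : Set Y).Nonempty → V.ι ≫ fY = φ ≫ f₁ →
        ∃ (Y' : Scheme.{0}) (g : Y' ⟶ Y) (ψ : Y' ⟶ X₁), IsProper g ∧ IsIntegral Y' ∧
          Scheme.IsRegular Y' ∧ Function.Surjective g.base ∧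
          (∃ V' : Y.Opens, Dense (V' : Set Y) ∧ IsFinite (g ∣_ V') ∧
            UniversallyInjective (g ∣_ V')) ∧
          ψ ≫ f₁ = g ≫ fY ∧ (g ⁻¹ᵁ V).ι ≫ ψ = (g ∣_ V) ≫ φ)
    (hH : ∀ (n : ℕ) (H : Scheme.{0}) (ι : H ⟶ (Literature.AlgebraicGeometry.Motives.projectiveSpace (n + 1) k).left),
      IsClosedImmersion ι → IsIntegral H → topologicalKrullDim H = (n : WithBot ℕ∞) →
      ∃ (H' : Scheme.{0}) (g : H' ⟶ H), IsProper g ∧ IsIntegral H' ∧ Scheme.IsRegular H' ∧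
        Function.Surjective g.base ∧ ∃ U : H.Opens, Dense (U : Set H) ∧ IsFinite (g ∣_ U) ∧
          UniversallyInjective (g ∣_ U))
    (X : Scheme.{0}) (f : X ⟶ Spec (.of k)) [IsSeparated f] [LocallyOfFiniteType f]
    [QuasiCompact f] [IsIntegral X] :
    ∃ (X' : Scheme.{0}) (g : X' ⟶ X), IsProper g ∧ IsIntegral X' ∧ Scheme.IsRegular X' ∧
      Function.Surjective g.base ∧ ∃ U : X.Opens, Dense (U : Set X) ∧ IsFinite (g ∣_ U) ∧
        UniversallyInjective (g ∣_ U) :=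
  pialtConclusion_of_forall_normal_proper f fun X' f' hf' hi' _ => by
    haveI := hf'; haveI := hi'
    exact pialtShape_proper_of_frobIndet_hypersurfacePialt p hp k hI hH X' f'

/-! ## The split glue: the crux `Pialt` by name from `FrobIndet ∧ HypersurfacePialt` -/

/-- **SPLIT GLUE (birational seam).** `Pialt` follows from **FrobIndet** (purely inseparable
elimination of indeterminacy out of regular proper varieties) and **HypersurfacePialt** (the crux
for integral hypersurfaces of projective spaces), both over PERFECT fields of every prime
characteristic; the hypotheses `hI p hp k` / `hH p hp k` are, verbatim, the registered stubs
`stub_frobIndet p hp k` / `stub_hypersurfacePialt p hp k` of the line `IndeterminacySplit`.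
Perfect fields suffice by `stub_pialtOfPerfect`. [cite: AbramovichOort2000, Q. 2.13] -/
theorem pialt_of_frobIndet_hypersurfacePialt
    (hI : ∀ p : ℕ, p.Prime → ∀ (k : Type) [Field k] [CharP k p] [PerfectField k]
      (Y X₁ : Scheme.{0}) (fY : Y ⟶ Spec (.of k)) (f₁ : X₁ ⟶ Spec (.of k)), IsProper fY →
      IsProper f₁ → IsIntegral Y → Scheme.IsRegular Y → IsIntegral X₁ →
      ∀ (V : Y.Opens) (φ : (V : Scheme.{0}) ⟶ X₁), (V : Set Y).Nonempty → V.ι ≫ fY = φ ≫ f₁ →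
        ∃ (Y' : Scheme.{0}) (g : Y' ⟶ Y) (ψ : Y' ⟶ X₁), IsProper g ∧ IsIntegral Y' ∧
          Scheme.IsRegular Y' ∧ Function.Surjective g.base ∧
          (∃ V' : Y.Opens, Dense (V' : Set Y) ∧ IsFinite (g ∣_ V') ∧
            UniversallyInjective (g ∣_ V')) ∧
          ψ ≫ f₁ = g ≫ fY ∧ (g ⁻¹ᵁ V).ι ≫ ψ = (g ∣_ V) ≫ φ)
    (hH : ∀ p : ℕ, p.Prime → ∀ (k : Type) [Field k] [CharP k p] [PerfectField k] (n : ℕ)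
      (H : Scheme.{0}) (ι : H ⟶ (Literature.AlgebraicGeometry.Motives.projectiveSpace (n + 1) k).left),
      IsClosedImmersion ι → IsIntegral H → topologicalKrullDim H = (n : WithBot ℕ∞) →
      ∃ (H' : Scheme.{0}) (g : H' ⟶ H), IsProper g ∧ IsIntegral H' ∧ Scheme.IsRegular H' ∧
        Function.Surjective g.base ∧ ∃ U : H.Opens, Dense (U : Set H) ∧ IsFinite (g ∣_ U) ∧
          UniversallyInjective (g ∣_ U)) :
    Summit.ResolutionOfSingularities.ResolutionOfSingularities.Theses.PAlteration.Pialt := by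
  intro p hp k _ _ X f hs hl hq hi
  haveI : Fact p.Prime := ⟨hp⟩
  haveI := hs; haveI := hl; haveI := hq; haveI := hi
  exact PalterationThesis.PerfectTransfer.stub_pialtOfPerfect p k
    (fun Y g hs' hl' hq' hi' => by
      haveI := hs'; haveI := hl'; haveI := hq'; haveI := hi'
      exact pialtShape_of_frobIndet_hypersurfacePialt p hp (PerfectClosure k p)
        (fun Y₀ X₁ fY f₁ => hI p hp (PerfectClosure k p) Y₀ X₁ fY f₁)
        (fun n H ι => hH p hp (PerfectClosure k p) n H ι) Y g)
    X f

end Summit.ResolutionOfSingularities.ResolutionOfSingularities.Theorems.Pialt.IndeterminacySplit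

end
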